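import Literature.NumberTheory.Automorphic.ArchTorusOneAngleCurve      -- ★ (V4): `eventually_injective_splitCurve`
import Mathlib.Analysis.Calculus.Deriv.Basic
import HarnessLib

/-!
# THE PLACE-BY-PLACE INDUCTION of the «method of §8.2» — abstract form: two systems with the same one-step jump law and equal regular states have equal end states
# ((R1-e-core) of R1 «(L-use) at all indefinite places»; Rogawski 1990 §8.2 p. 122–124, §14.5 p. 238–239)

Topic `NumberTheory/Rogawski1990`; namespace `Literature.NumberTheory.Rogawski1990.PlaceInduction`.  THEOREMS ONLY (no `def`, no instance, no notation, no axiom, no `sorry`).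
Cell `pub/hodgecm-mathlib`, ENGINE T1 (crux H413 = `stmt-HodgeConjecture-24833`); floor-2 road «(J-nc) in-house», brick (R1-e-core) of R1 `stub_LuseAllPlaces` (LEAD F0P3a-plan (g9)
WORD T8-77; census `CENSUS-R1e-LuseAssembly` 31a194b6; author F0P3a-p07 (g7), 2026-09-01).

WHAT (pure bookkeeping — no measure theory, no group theory).  Index set `W` (the complex places), per place a type `X v` (the Radon measures on `G_v`), a predicate `P v` (Radon-ness), a
«state» functional `I : (Π v, X v) → ℂ` (the orbit-measure integral `∫ Θ ↑↑(e⁻¹ o) d(⊗_v μ_v)`), REGULAR data `R v : (Fin 3 → S¹) → X v` (regular orbit measures), WALL data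
`Wm v : S₃ → X v` with coefficients `κ v : S₃ → ℂ` (the compact-wall ∕ singular orbit measures at the wall point `z⁰_v ∘ ρ` with `2` ∕ `c_v(ρ⁻¹)`), and the ONE-STEP JUMP LAW
`hstep` in finite-linear-combination form (★ p841391 (R1-e′) supplies it): for `P`-families `μ_i` and scalars `s_i`,
`∂_ψ [2 sin ψ · Σ_i s_i Σ_ρ I(μ_i[w ↦ R_w(γ_{z⁰_w}(ψ)∘ρ)])] ⟶ Σ_i s_i Σ_ρ κ_w(ρ) I(μ_i[w ↦ Wm_w(ρ)])` (`ψ → 0+`).  THEOREM `sum_prod_mul_eq_of_step_of_regular_eq`: if two such systems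
(`I, R, Wm, κ` and `I′, R′, Wm′, κ′`, same `W`, same wall points `z⁰`) have EQUAL REGULAR STATES `Σ_ρ I(v ↦ R_v(z_v∘ρ_v)) = Σ_ρ I′(v ↦ R′_v(z_v∘ρ_v))` at every regular `z`, then their END
STATES agree: `Σ_ρ (Π_v κ_v(ρ_v))·I(v ↦ Wm_v(ρ_v)) = Σ_ρ (Π_v κ′_v(ρ_v))·I′(v ↦ Wm′_v(ρ_v))` — by induction on the set `S` of processed places, the state after `S` being
`Σ_ρ (Π_{v∈S} κ_v(ρ_v))·I(v ↦ v ∈ S ? Wm_v(ρ_v) : R_v(z_v∘ρ_v))`; at the step the two sides agree on the punctured window where the moving coordinate is regular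
(★ `eventually_injective_splitCurve`), so their jump limits agree (`tendsto_nhds_unique_of_eventuallyEq` on `𝓝[>] 0`).
HONEST LABEL: HC_CM is proved only modulo the 7 printed citations until rung 0 closes; this file is bookkeeping and pays nothing by itself.

## References
* [Rogawski1990] J. D. Rogawski, *Automorphic Representations of Unitary Groups in Three Variables*, Ann. of Math. Stud. 123 (1990), §8.2 p. 122–124, §14.5 p. 238–239
  («the same argument as in §8.2», applied place by place to both sides of (14.2.1)).
* [Varadarajan1989] V. S. Varadarajan, *An Introduction to Harmonic Analysis on Semisimple Lie Groups* (1989), §6.4 Thm 22.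
-/

set_option autoImplicit false

noncomputable section

open Filter Topology Equiv Function Set Literature.NumberTheory.Automorphic Literature.NumberTheory.Automorphic.UnitaryGroup
open scoped BigOperators

namespace Literature.NumberTheory.Rogawski1990.PlaceInduction

variable {W : Type} [Fintype W] [DecidableEq W] {X X' : W → Type*}

/-! ## §1 Bookkeeping: the state families and their reading at a distinguished place -/

/-- Reindexing `ρ : W → S₃` by (`ρ_w`, `ρ` off `w`) (Mathlib `Equiv.funSplitAt`, `Fintype.sum_prod_type_right'`). [cite: Rogawski1990, §8.2 p. 122] -/
theorem sum_eq_sum_sum_funSplitAt (w : W) {M : Type*} [AddCommMonoid M] (g : Perm (Fin 3) → ({v : W // v ≠ w} → Perm (Fin 3)) → M) :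
    ∑ ρ : W → Perm (Fin 3), g (ρ w) (fun v => ρ v.1) = ∑ ρ' : {v : W // v ≠ w} → Perm (Fin 3), ∑ ρ₀ : Perm (Fin 3), g ρ₀ ρ' := by
  rw [← Fintype.sum_prod_type_right' g]
  exact Equiv.sum_comp (Equiv.funSplitAt w (Perm (Fin 3))) (fun p => g p.1 p.2)

omit [Fintype W] in
/-- Off `w`, a relabelling split as `(ρ₀, ρ′)` acts by `ρ′`. [cite: Rogawski1990, §8.2 p. 122] -/
theorem funSplitAt_symm_apply_coe (w : W) (p : Perm (Fin 3) × ({v : W // v ≠ w} → Perm (Fin 3))) (v : {v : W // v ≠ w}) :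
    (Equiv.funSplitAt w (Perm (Fin 3))).symm p v.1 = p.2 v := by
  rw [Equiv.funSplitAt_symm_apply, dif_neg v.2]

omit [Fintype W] in
/-- At `w`, a relabelling split as `(ρ₀, ρ′)` acts by `ρ₀`. [cite: Rogawski1990, §8.2 p. 122] -/
theorem funSplitAt_symm_apply_self (w : W) (p : Perm (Fin 3) × ({v : W // v ≠ w} → Perm (Fin 3))) :
    (Equiv.funSplitAt w (Perm (Fin 3))).symm p w = p.1 := by
  rw [Equiv.funSplitAt_symm_apply, dif_pos rfl]

omit [Fintype W] in
/-- The product of coefficients over `insert w S` splits off the `w`-factor. [cite: Rogawski1990, §8.2 p. 122] -/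
theorem prod_insert_coef {S : Finset W} {w : W} (hw : w ∉ S) (κ : ∀ v : W, Perm (Fin 3) → ℂ) (ρ : W → Perm (Fin 3)) :
    (∏ v ∈ insert w S, κ v (ρ v)) = κ w (ρ w) * ∏ v ∈ S, κ v (ρ v) :=
  Finset.prod_insert hw

/-! ## §2 The induction -/

/-- **THE PLACE-BY-PLACE INDUCTION (abstract form).**  Two systems `(I, R, Wm, κ)` on `X` and `(I′, R′, Wm′, κ′)` on `X′` over the same places `W`, Radon-ness predicates `P`, `P′`
preserved by the data, the SAME one-step jump law at every place (finite-linear-combination form, `ψ → 0+` along the split curve through the wall point `z⁰_w`), and EQUAL REGULAR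
STATES ⇒ EQUAL END STATES.  (The (L-use) reading: `X_v` = Radon measures on `G_v`, `I` = `∫ Θ ↑↑(e⁻¹ o) d(⊗_v ·)`, `R_v` = regular orbit measures, `Wm_v`∕`κ_v` = wall orbit measures and
jump coefficients, `hstep` = ★ p841391, `hreg` = ★ (14.2.1) through ★ p841429.) [cite: Rogawski1990, §8.2 p. 124; §14.5 p. 238–239] [cite: Varadarajan1989, §6.4 Thm 22] -/
theorem sum_prod_mul_eq_of_step_of_regular_eq
    (P : ∀ v : W, X v → Prop) (P' : ∀ v : W, X' v → Prop)
    (I : (∀ v, X v) → ℂ) (I' : (∀ v, X' v) → ℂ)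
    (R : ∀ v : W, (Fin 3 → Circle) → X v) (R' : ∀ v : W, (Fin 3 → Circle) → X' v)
    (Wm : ∀ v : W, Perm (Fin 3) → X v) (Wm' : ∀ v : W, Perm (Fin 3) → X' v)
    (κ κ' : ∀ v : W, Perm (Fin 3) → ℂ) (z0 : W → Fin 3 → Circle)
    (hwall : ∀ v, z0 v 0 = z0 v 2 ∧ z0 v 0 ≠ z0 v 1)
    (hR : ∀ v u, Function.Injective u → P v (R v u)) (hR' : ∀ v u, Function.Injective u → P' v (R' v u))
    (hWm : ∀ v ρ, P v (Wm v ρ)) (hWm' : ∀ v ρ, P' v (Wm' v ρ))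
    (hstep : ∀ (w : W) (ι : Type) [Fintype ι] (s : ι → ℂ) (μ : ι → ∀ v, X v), (∀ i v, P v (μ i v)) →
      Tendsto (fun ψ : ℝ => deriv (fun ψ : ℝ => (2 * Real.sin ψ : ℂ) * ∑ i, s i * ∑ ρ : Perm (Fin 3),
          I (Function.update (μ i) w (R w ((fun j => z0 w j * Circle.exp (![(1 : ℝ), 0, -1] j * ψ)) ∘ ⇑ρ)))) ψ)
        (𝓝[>] 0) (𝓝 (∑ i, s i * ∑ ρ : Perm (Fin 3), κ w ρ * I (Function.update (μ i) w (Wm w ρ)))))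
    (hstep' : ∀ (w : W) (ι : Type) [Fintype ι] (s : ι → ℂ) (μ : ι → ∀ v, X' v), (∀ i v, P' v (μ i v)) →
      Tendsto (fun ψ : ℝ => deriv (fun ψ : ℝ => (2 * Real.sin ψ : ℂ) * ∑ i, s i * ∑ ρ : Perm (Fin 3),
          I' (Function.update (μ i) w (R' w ((fun j => z0 w j * Circle.exp (![(1 : ℝ), 0, -1] j * ψ)) ∘ ⇑ρ)))) ψ)
        (𝓝[>] 0) (𝓝 (∑ i, s i * ∑ ρ : Perm (Fin 3), κ' w ρ * I' (Function.update (μ i) w (Wm' w ρ)))))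
    (hreg : ∀ z : W → Fin 3 → Circle, (∀ v, Function.Injective (z v)) →
      ∑ ρ : W → Perm (Fin 3), I (fun v => R v (z v ∘ ⇑(ρ v))) = ∑ ρ : W → Perm (Fin 3), I' (fun v => R' v (z v ∘ ⇑(ρ v)))) :
    ∑ ρ : W → Perm (Fin 3), (∏ v, κ v (ρ v)) * I (fun v => Wm v (ρ v)) =
      ∑ ρ : W → Perm (Fin 3), (∏ v, κ' v (ρ v)) * I' (fun v => Wm' v (ρ v)) := by
  classical
  -- the claim for a processed set `S`: the `S`-states agree at every `z` regular off `S`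
  suffices hS : ∀ S : Finset W, ∀ z : W → Fin 3 → Circle, (∀ v, v ∉ S → Function.Injective (z v)) →
      ∑ ρ : W → Perm (Fin 3), (∏ v ∈ S, κ v (ρ v)) * I (fun v => if v ∈ S then Wm v (ρ v) else R v (z v ∘ ⇑(ρ v))) =
        ∑ ρ : W → Perm (Fin 3), (∏ v ∈ S, κ' v (ρ v)) * I' (fun v => if v ∈ S then Wm' v (ρ v) else R' v (z v ∘ ⇑(ρ v))) by
    simpa using hS Finset.univ z0 (fun v hv => absurd (Finset.mem_univ v) hv)
  intro S
  induction S using Finset.induction_on with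
  | empty =>
    intro z hz
    simpa using hreg z fun v => hz v (Finset.notMem_empty v)
  | @insert w S hw ih =>
    intro z hz
    -- the regularity window at `w`
    have hev : ∀ᶠ ψ in 𝓝[>] (0 : ℝ), Function.Injective fun j => z0 w j * Circle.exp (![(1 : ℝ), 0, -1] j * ψ) :=
      (eventually_injective_splitCurve (z0 w) (hwall w).1 (hwall w).2).filter_mono (nhdsWithin_mono _ fun x (hx : 0 < x) => ne_of_gt hx)
    -- the base families (value at `w` a dummy `P`-element), indexed by ALL relabellings but depending only on `ρ` off `w`
    set μ : (W → Perm (Fin 3)) → ∀ v, X v := fun ρ =>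
      Function.update (fun v => if v ∈ S then Wm v (ρ v) else R v (z v ∘ ⇑(ρ v))) w (Wm w 1) with hμ
    set μ' : (W → Perm (Fin 3)) → ∀ v, X' v := fun ρ =>
      Function.update (fun v => if v ∈ S then Wm' v (ρ v) else R' v (z v ∘ ⇑(ρ v))) w (Wm' w 1) with hμ'
    have hμP : ∀ ρ v, P v (μ ρ v) := fun ρ v => by
      rw [hμ]; dsimp only
      by_cases hv : v = w
      · subst hv; rw [Function.update_self]; exact hWm _ _
      · rw [Function.update_of_ne hv]
        by_cases hvS : v ∈ S
        · rw [if_pos hvS]; exact hWm _ _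
        · rw [if_neg hvS]; exact hR _ _ ((hz v (by simp [hv, hvS])).comp (ρ v).injective)
    have hμP' : ∀ ρ v, P' v (μ' ρ v) := fun ρ v => by
      rw [hμ']; dsimp only
      by_cases hv : v = w
      · subst hv; rw [Function.update_self]; exact hWm' _ _
      · rw [Function.update_of_ne hv]
        by_cases hvS : v ∈ S
        · rw [if_pos hvS]; exact hWm' _ _
        · rw [if_neg hvS]; exact hR' _ _ ((hz v (by simp [hv, hvS])).comp (ρ v).injective)
    -- notation: the curve at `w`, the extension of an off-`w` relabelling by `1` at `w`
    set γ : ℝ → Fin 3 → Circle := fun ψ j => z0 w j * Circle.exp (![(1 : ℝ), 0, -1] j * ψ) with hγ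
    set ext : ({v : W // v ≠ w} → Perm (Fin 3)) → (W → Perm (Fin 3)) := fun ρ' => (Equiv.funSplitAt w (Perm (Fin 3))).symm (1, ρ') with hext
    have hext_coe : ∀ (ρ' : {v : W // v ≠ w} → Perm (Fin 3)) (v : {v : W // v ≠ w}), ext ρ' v.1 = ρ' v := fun ρ' v => by
      rw [hext]; exact funSplitAt_symm_apply_coe w (1, ρ') v
    have hext_res : ∀ (ρ : W → Perm (Fin 3)) (v : W), v ≠ w → ext (fun u : {v : W // v ≠ w} => ρ u.1) v = ρ v :=
      fun ρ v hv => hext_coe (fun u => ρ u.1) ⟨v, hv⟩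
    -- the coefficients over `S` and the base families only see `ρ` off `w`
    have hcoef : ∀ (κ₀ : ∀ v : W, Perm (Fin 3) → ℂ) (ρ : W → Perm (Fin 3)),
        (∏ v ∈ S, κ₀ v (ρ v)) = ∏ v ∈ S, κ₀ v (ext (fun u => ρ u.1) v) := fun κ₀ ρ =>
      Finset.prod_congr rfl fun v hv => by rw [hext_res ρ v (fun h => hw (h ▸ hv))]
    have hμext : ∀ ρ : W → Perm (Fin 3), μ ρ = μ (ext fun u => ρ u.1) := fun ρ => by
      funext v
      by_cases hv : v = w
      · subst hv; simp only [hμ, Function.update_self]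
      · simp only [hμ, Function.update_of_ne hv, hext_res ρ v hv]
    have hμext' : ∀ ρ : W → Perm (Fin 3), μ' ρ = μ' (ext fun u => ρ u.1) := fun ρ => by
      funext v
      by_cases hv : v = w
      · subst hv; simp only [hμ', Function.update_self]
      · simp only [hμ', Function.update_of_ne hv, hext_res ρ v hv]
    -- the `S`-state at `z[w ↦ u]` and the `insert w S`-state, read through the base families
    have hfamS : ∀ (ρ : W → Perm (Fin 3)) (u : Fin 3 → Circle),
        (fun v => if v ∈ S then Wm v (ρ v) else R v (Function.update z w u v ∘ ⇑(ρ v))) = Function.update (μ ρ) w (R w (u ∘ ⇑(ρ w))) := by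
      intro ρ u; funext v
      by_cases hv : v = w
      · subst hv; simp only [Function.update_self, if_neg hw]
      · simp only [hμ, Function.update_of_ne hv]
    have hfamS' : ∀ (ρ : W → Perm (Fin 3)) (u : Fin 3 → Circle),
        (fun v => if v ∈ S then Wm' v (ρ v) else R' v (Function.update z w u v ∘ ⇑(ρ v))) = Function.update (μ' ρ) w (R' w (u ∘ ⇑(ρ w))) := by
      intro ρ u; funext v
      by_cases hv : v = w
      · subst hv; simp only [Function.update_self, if_neg hw]
      · simp only [hμ', Function.update_of_ne hv]
    have hfamI : ∀ ρ : W → Perm (Fin 3),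
        (fun v => if v ∈ insert w S then Wm v (ρ v) else R v (z v ∘ ⇑(ρ v))) = Function.update (μ ρ) w (Wm w (ρ w)) := by
      intro ρ; funext v
      by_cases hv : v = w
      · subst hv; simp only [Function.update_self, Finset.mem_insert_self, if_true]
      · simp only [hμ, Function.update_of_ne hv, Finset.mem_insert, hv, false_or]
    have hfamI' : ∀ ρ : W → Perm (Fin 3),
        (fun v => if v ∈ insert w S then Wm' v (ρ v) else R' v (z v ∘ ⇑(ρ v))) = Function.update (μ' ρ) w (Wm' w (ρ w)) := by
      intro ρ; funext v
      by_cases hv : v = w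
      · subst hv; simp only [Function.update_self, Finset.mem_insert_self, if_true]
      · simp only [hμ', Function.update_of_ne hv, Finset.mem_insert, hv, false_or]
    -- the one-step jump on both sides, indexed by the off-`w` relabellings `ρ'`, weights `Π_{v∈S} κ_v`
    have hT := hstep w ({v : W // v ≠ w} → Perm (Fin 3)) (fun ρ' => ∏ v ∈ S, κ v (ext ρ' v)) (fun ρ' => μ (ext ρ')) fun ρ' v => hμP _ v
    have hT' := hstep' w ({v : W // v ≠ w} → Perm (Fin 3)) (fun ρ' => ∏ v ∈ S, κ' v (ext ρ' v)) (fun ρ' => μ' (ext ρ')) fun ρ' v => hμP' _ v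
    -- regrouping `Σ_ρ = Σ_{ρ'} Σ_{ρ₀}` of the `S`-states at `z[w ↦ u]` and of the `insert w S`-states
    have hregroupS : ∀ u : Fin 3 → Circle,
        ∑ ρ : W → Perm (Fin 3), (∏ v ∈ S, κ v (ρ v)) * I (fun v => if v ∈ S then Wm v (ρ v) else R v (Function.update z w u v ∘ ⇑(ρ v))) =
          ∑ ρ' : {v : W // v ≠ w} → Perm (Fin 3), (∏ v ∈ S, κ v (ext ρ' v)) *
            ∑ ρ₀ : Perm (Fin 3), I (Function.update (μ (ext ρ')) w (R w (u ∘ ⇑ρ₀))) := by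
      intro u
      simp only [Finset.mul_sum]
      rw [← sum_eq_sum_sum_funSplitAt w (fun ρ₀ ρ' => (∏ v ∈ S, κ v (ext ρ' v)) * I (Function.update (μ (ext ρ')) w (R w (u ∘ ⇑ρ₀))))]
      · exact Fintype.sum_congr _ _ fun ρ => by rw [hfamS, hcoef κ ρ, hμext ρ]
    have hregroupS' : ∀ u : Fin 3 → Circle,
        ∑ ρ : W → Perm (Fin 3), (∏ v ∈ S, κ' v (ρ v)) * I' (fun v => if v ∈ S then Wm' v (ρ v) else R' v (Function.update z w u v ∘ ⇑(ρ v))) =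
          ∑ ρ' : {v : W // v ≠ w} → Perm (Fin 3), (∏ v ∈ S, κ' v (ext ρ' v)) *
            ∑ ρ₀ : Perm (Fin 3), I' (Function.update (μ' (ext ρ')) w (R' w (u ∘ ⇑ρ₀))) := by
      intro u
      simp only [Finset.mul_sum]
      rw [← sum_eq_sum_sum_funSplitAt w (fun ρ₀ ρ' => (∏ v ∈ S, κ' v (ext ρ' v)) * I' (Function.update (μ' (ext ρ')) w (R' w (u ∘ ⇑ρ₀))))]
      · exact Fintype.sum_congr _ _ fun ρ => by rw [hfamS', hcoef κ' ρ, hμext' ρ]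
    have hregroupI :
        ∑ ρ : W → Perm (Fin 3), (∏ v ∈ insert w S, κ v (ρ v)) * I (fun v => if v ∈ insert w S then Wm v (ρ v) else R v (z v ∘ ⇑(ρ v))) =
          ∑ ρ' : {v : W // v ≠ w} → Perm (Fin 3), (∏ v ∈ S, κ v (ext ρ' v)) *
            ∑ ρ₀ : Perm (Fin 3), κ w ρ₀ * I (Function.update (μ (ext ρ')) w (Wm w ρ₀)) := by
      simp only [Finset.mul_sum]
      rw [← sum_eq_sum_sum_funSplitAt w (fun ρ₀ ρ' => (∏ v ∈ S, κ v (ext ρ' v)) * (κ w ρ₀ * I (Function.update (μ (ext ρ')) w (Wm w ρ₀))))]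
      · refine Fintype.sum_congr _ _ fun ρ => ?_
        rw [hfamI, prod_insert_coef hw, hcoef κ ρ, hμext ρ]
        ring
    have hregroupI' :
        ∑ ρ : W → Perm (Fin 3), (∏ v ∈ insert w S, κ' v (ρ v)) * I' (fun v => if v ∈ insert w S then Wm' v (ρ v) else R' v (z v ∘ ⇑(ρ v))) =
          ∑ ρ' : {v : W // v ≠ w} → Perm (Fin 3), (∏ v ∈ S, κ' v (ext ρ' v)) *
            ∑ ρ₀ : Perm (Fin 3), κ' w ρ₀ * I' (Function.update (μ' (ext ρ')) w (Wm' w ρ₀)) := by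
      simp only [Finset.mul_sum]
      rw [← sum_eq_sum_sum_funSplitAt w (fun ρ₀ ρ' => (∏ v ∈ S, κ' v (ext ρ' v)) * (κ' w ρ₀ * I' (Function.update (μ' (ext ρ')) w (Wm' w ρ₀))))]
      · refine Fintype.sum_congr _ _ fun ρ => ?_
        rw [hfamI', prod_insert_coef hw, hcoef κ' ρ, hμext' ρ]
        ring
    -- the two functions under `deriv` agree on the regularity window (IH at `z[w ↦ γ ψ]`)
    have hwin : ∀ ψ : ℝ, Function.Injective (γ ψ) →
        (2 * Real.sin ψ : ℂ) * ∑ ρ' : {v : W // v ≠ w} → Perm (Fin 3), (∏ v ∈ S, κ v (ext ρ' v)) *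
            ∑ ρ₀ : Perm (Fin 3), I (Function.update (μ (ext ρ')) w (R w (γ ψ ∘ ⇑ρ₀))) =
        (2 * Real.sin ψ : ℂ) * ∑ ρ' : {v : W // v ≠ w} → Perm (Fin 3), (∏ v ∈ S, κ' v (ext ρ' v)) *
            ∑ ρ₀ : Perm (Fin 3), I' (Function.update (μ' (ext ρ')) w (R' w (γ ψ ∘ ⇑ρ₀))) := by
      intro ψ hψ
      have hzψ : ∀ v, v ∉ S → Function.Injective (Function.update z w (γ ψ) v) := fun v hv => by
        by_cases hvw : v = w
        · subst hvw; rw [Function.update_self]; exact hψ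
        · rw [Function.update_of_ne hvw]; exact hz v (by simp [hvw, hv])
      rw [← hregroupS (γ ψ), ← hregroupS' (γ ψ), ih (Function.update z w (γ ψ)) hzψ]
    -- hence the derivatives agree near `0+` and the two jump limits coincide
    obtain ⟨ε, hε, hregε⟩ : ∃ ε > 0, ∀ ψ : ℝ, 0 < ψ → ψ < ε → Function.Injective (γ ψ) := by
      have h := hev
      rw [eventually_nhdsWithin_iff, Metric.eventually_nhds_iff] at h
      obtain ⟨ε, hε, h⟩ := h
      exact ⟨ε, hε, fun ψ h0 hψε => h (by rw [Real.dist_eq, sub_zero, abs_of_pos h0]; exact hψε) h0⟩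
    have hderiv : (fun ψ : ℝ => deriv (fun ψ : ℝ => (2 * Real.sin ψ : ℂ) * ∑ ρ' : {v : W // v ≠ w} → Perm (Fin 3), (∏ v ∈ S, κ v (ext ρ' v)) *
            ∑ ρ₀ : Perm (Fin 3), I (Function.update (μ (ext ρ')) w (R w ((fun j => z0 w j * Circle.exp (![(1 : ℝ), 0, -1] j * ψ)) ∘ ⇑ρ₀)))) ψ) =ᶠ[𝓝[>] 0]
        (fun ψ : ℝ => deriv (fun ψ : ℝ => (2 * Real.sin ψ : ℂ) * ∑ ρ' : {v : W // v ≠ w} → Perm (Fin 3), (∏ v ∈ S, κ' v (ext ρ' v)) *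
            ∑ ρ₀ : Perm (Fin 3), I' (Function.update (μ' (ext ρ')) w (R' w ((fun j => z0 w j * Circle.exp (![(1 : ℝ), 0, -1] j * ψ)) ∘ ⇑ρ₀)))) ψ) := by
      filter_upwards [Ioo_mem_nhdsGT hε] with ψ hψ
      refine Filter.EventuallyEq.deriv_eq ?_
      filter_upwards [isOpen_Ioo.mem_nhds hψ] with ψ' hψ'
      exact hwin ψ' (hregε ψ' hψ'.1 hψ'.2)
    have hlim := tendsto_nhds_unique_of_eventuallyEq hT hT' hderiv
    rw [hregroupI, hregroupI']
    exact hlim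

end Literature.NumberTheory.Rogawski1990.PlaceInduction

end
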